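import Mathlib
import Summits.Ventures.PercRepro2.SwOutMixedArmsBaseDual

/-!
# The several-arms base: the edge map and membership in the predicted red cluster (blind cell
PercRepro2, night-4 g20, 2026-08-27; proofs/NIGHT4-G20.md §4′)

The monotone map `φR` of atom sets to edge sets of the transfer `card_le_of_mixedArms_edges`: an
atom's RED CLASS is the set of base-red edges inside the corresponding arm together with `h`
(and `u` for a u-arm), the u–p_r edges for the atom `P_r`, nothing for `u`.  Also: which
predicted-red-cluster memberships the coordinates decide (`mem_redSetR_U` / `_Ah` / `_F` / `_u` /
`_p`, `not_mem_redSetR_of_out`).  The single-arm twin is `SwOutMixedCoreEdgeMap`.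
-/

namespace Summit.Ventures.PercRepro2

namespace MixedArms

open Hull LocRows

variable {V : Type*} {E : Type*}

open scoped Classical

section EdgeMap

variable (ends : E → Sym2 V) (σ : Config E) (h u : V) {ι ρ ν κ : Type*} (U : ι → Set V)
  (p : ρ → V) (Ah : ν → Set V) (F : κ → Set V)

/-- The red edges of an atom at the base: inside a u-arm with `h` and `u`, inside a piece or a far
arm with `h`, the u–p_r edges for `P_r`, nothing for `u`. -/
def redClassR (α : AtomR ι ρ ν κ) : Set E :=
  match α with
  | Sum.inl j => {e | σ e = true ∧ e ∈ within ends (U j ∪ {h, u})}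
  | Sum.inr (Sum.inl ()) => ∅
  | Sum.inr (Sum.inr (Sum.inl i)) => {e | σ e = true ∧ e ∈ within ends (Ah i ∪ {h})}
  | Sum.inr (Sum.inr (Sum.inr (Sum.inl r))) => clsUPR ends u p r
  | Sum.inr (Sum.inr (Sum.inr (Sum.inr k))) => {e | σ e = true ∧ e ∈ within ends (F k ∪ {h})}

/-- The edge map of the transfer: the union of the red classes of the atoms of a set. -/
def φR (S : Set (AtomR ι ρ ν κ)) : Set E := ⋃ α ∈ S, redClassR ends σ h u U p Ah F α

/-- `φR` is monotone. -/
lemma φR_mono : Monotone (φR ends σ h u U p Ah F) := by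
  intro S S' hSS' e he
  simp only [φR, Set.mem_iUnion, exists_prop] at he ⊢
  obtain ⟨α, hα, he⟩ := he
  exact ⟨α, hSS' hα, he⟩

/-- Membership in `φR`. -/
lemma mem_φR {S : Set (AtomR ι ρ ν κ)} {e : E} :
    e ∈ φR ends σ h u U p Ah F S ↔ ∃ α ∈ S, e ∈ redClassR ends σ h u U p Ah F α := by
  simp only [φR, Set.mem_iUnion, exists_prop]

/-- The red class of a u-arm. -/
lemma redClassR_inl (j : ι) :
    redClassR ends σ h u U p Ah F (Sum.inl j) =
      {e | σ e = true ∧ e ∈ within ends (U j ∪ {h, u})} := rfl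

/-- The red class of `u` is empty. -/
lemma redClassR_u : redClassR ends σ h u U p Ah F (Sum.inr (Sum.inl ())) = ∅ := rfl

/-- The red class of a piece. -/
lemma redClassR_a (i : ν) :
    redClassR ends σ h u U p Ah F (Sum.inr (Sum.inr (Sum.inl i))) =
      {e | σ e = true ∧ e ∈ within ends (Ah i ∪ {h})} := rfl

/-- The red class of a dropped vertex: its u–p edges. -/
lemma redClassR_p (r : ρ) :
    redClassR ends σ h u U p Ah F (Sum.inr (Sum.inr (Sum.inr (Sum.inl r)))) =
      clsUPR ends u p r := rfl

/-- The red class of a far arm. -/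
lemma redClassR_f (k : κ) :
    redClassR ends σ h u U p Ah F (Sum.inr (Sum.inr (Sum.inr (Sum.inr k)))) =
      {e | σ e = true ∧ e ∈ within ends (F k ∪ {h})} := rfl

end EdgeMap

section RedSetMembership

variable {ends : E → Sym2 V} {σ : Config E} {h u : V} {ι ρ ν κ : Type*} {U : ι → Set V}
  {p : ρ → V} {Ah : ν → Set V} {arm : ν → ρ} {F : κ → Set V}
  (hb : MixedBaseR ends σ h u U p Ah arm F)
include hb

/-- A vertex of a u-arm is in the predicted red cluster iff the arm is red. -/
lemma MixedBaseR.mem_redSetR_U {q : PtR ι ρ ν κ} {j : ι} {x : V} (hx : x ∈ U j) :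
    x ∈ redSetR h u U p Ah F q ↔ q.1 j = true := by
  rw [mem_redSetR_iff]
  constructor
  · rintro (rfl | ⟨j', hj', hx'⟩ | ⟨rfl, _⟩ | ⟨r, rfl, _⟩ | ⟨i, _, hx'⟩ | ⟨k, _, hx'⟩)
    · exact absurd hx (hb.h_notMem_U j)
    · by_cases hjj : j = j'
      · subst hjj
        exact hj'
      · exact absurd hx' (hb.U_disj j j' hjj x hx)
    · exact absurd hx (hb.u_notMem_U j)
    · exact absurd hx (hb.p_notMem_U r j)
    · exact absurd hx' (hb.U_disj_Ah j i x hx)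
    · exact absurd hx' (hb.U_disj_F j k x hx)
  · intro hj
    exact Or.inr (Or.inl ⟨j, hj, hx⟩)

/-- A vertex of a piece is in the predicted red cluster iff the piece is red. -/
lemma MixedBaseR.mem_redSetR_Ah {q : PtR ι ρ ν κ} {i : ν} {x : V} (hx : x ∈ Ah i) :
    x ∈ redSetR h u U p Ah F q ↔ q.2.1 i = true := by
  rw [mem_redSetR_iff]
  constructor
  · rintro (rfl | ⟨j, _, hx'⟩ | ⟨rfl, _⟩ | ⟨r, rfl, _⟩ | ⟨i', hi', hx'⟩ | ⟨k, _, hx'⟩)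
    · exact absurd hx (hb.h_notMem_Ah i)
    · exact absurd hx (hb.U_disj_Ah j i x hx')
    · exact absurd hx (hb.u_notMem_Ah i)
    · exact absurd hx (hb.p_notMem_Ah r i)
    · by_cases hii : i = i'
      · subst hii
        exact hi'
      · exact absurd hx' (hb.Ah_disj i i' hii x hx)
    · exact absurd hx' (hb.Ah_disj_F i k x hx)
  · intro hi
    exact Or.inr (Or.inr (Or.inr (Or.inr (Or.inl ⟨i, hi, hx⟩))))

/-- A vertex of a far arm is in the predicted red cluster iff the arm is red. -/
lemma MixedBaseR.mem_redSetR_F {q : PtR ι ρ ν κ} {k : κ} {x : V} (hx : x ∈ F k) :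
    x ∈ redSetR h u U p Ah F q ↔ q.2.2.2.2 k = true := by
  rw [mem_redSetR_iff]
  constructor
  · rintro (rfl | ⟨j, _, hx'⟩ | ⟨rfl, _⟩ | ⟨r, rfl, _⟩ | ⟨i, _, hx'⟩ | ⟨k', hk', hx'⟩)
    · exact absurd hx (hb.h_notMem_F k)
    · exact absurd hx (hb.U_disj_F j k x hx')
    · exact absurd hx (hb.u_notMem_F k)
    · exact absurd hx (hb.p_notMem_F r k)
    · exact absurd hx (hb.Ah_disj_F i k x hx')
    · by_cases hkk : k = k'
      · subst hkk
        exact hk'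
      · exact absurd hx' (hb.F_disj k k' hkk x hx)
  · intro hk
    exact Or.inr (Or.inr (Or.inr (Or.inr (Or.inr ⟨k, hk, hx⟩))))

/-- `u` is in the predicted red cluster iff some u-arm is red. -/
lemma MixedBaseR.mem_redSetR_u {q : PtR ι ρ ν κ} :
    u ∈ redSetR h u U p Ah F q ↔ ∃ j, q.1 j = true := by
  rw [mem_redSetR_iff]
  constructor
  · rintro (huh | ⟨j, _, hx'⟩ | ⟨_, hs⟩ | ⟨r, hup, _⟩ | ⟨i, _, hx'⟩ | ⟨k, _, hx'⟩)
    · exact absurd huh.symm hb.hne_hu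
    · exact absurd hx' (hb.u_notMem_U j)
    · exact hs
    · exact absurd hup (hb.hne_up r)
    · exact absurd hx' (hb.u_notMem_Ah i)
    · exact absurd hx' (hb.u_notMem_F k)
  · intro hs
    exact Or.inr (Or.inr (Or.inl ⟨rfl, hs⟩))

/-- A dropped vertex is in the predicted red cluster iff some u-arm is red and its u–p edges are
red. -/
lemma MixedBaseR.mem_redSetR_p {q : PtR ι ρ ν κ} {r : ρ} :
    p r ∈ redSetR h u U p Ah F q ↔ (∃ j, q.1 j = true) ∧ q.2.2.1 r = true := by
  rw [mem_redSetR_iff]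
  constructor
  · rintro (hph | ⟨j, _, hx'⟩ | ⟨hpu, _⟩ | ⟨r', hpp, hs, huP⟩ | ⟨i, _, hx'⟩ | ⟨k, _, hx'⟩)
    · exact absurd hph.symm (hb.hne_hp r)
    · exact absurd hx' (hb.p_notMem_U r j)
    · exact absurd hpu.symm (hb.hne_up r)
    · rw [hb.p_inj hpp]
      exact ⟨hs, huP⟩
    · exact absurd hx' (hb.p_notMem_Ah r i)
    · exact absurd hx' (hb.p_notMem_F r k)
  · rintro ⟨hs, huP⟩
    exact Or.inr (Or.inr (Or.inr (Or.inl ⟨r, rfl, hs, huP⟩)))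

omit hb in
/-- A vertex outside `{h, u}`, the dropped vertices and the arms is never in the predicted red
cluster. -/
lemma not_mem_redSetR_of_out {q : PtR ι ρ ν κ} {x : V} (hxh : x ≠ h) (hxu : x ≠ u)
    (hxp : ∀ r, x ≠ p r) (hx : x ∉ armsAllR U Ah F) : x ∉ redSetR h u U p Ah F q := by
  intro hmem
  rcases redSetR_subset hmem with ((hx' | hx') | ⟨r, hx'⟩) | hx'
  · exact hxh hx'
  · exact hxu hx'
  · exact hxp r hx'.symm
  · exact hx hx'

end RedSetMembership

end MixedArms

end Summit.Ventures.PercRepro2
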